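import Mathlib
import Literature.Geometry.Lorentzian.KerrConvergence
import Literature.Geometry.Lorentzian.KerrSchildWaveCauchyProblem
import Literature.Geometry.Lorentzian.KerrTimeDerivative
import Summits.FinalStateConjecture.FinalStateConjecture.Theorems.StarvedNecksNecksCertifyStubHuygensNeckCutoff
import Summits.FinalStateConjecture.FinalStateConjecture.Theorems.StarvedNecksNecksCertifyStubHuygensNeckSphere

/-!
# Route StarvedNecks — crux `NecksCertify`, line `two-cap-focusing-ledger`: stub M2 (Huygens neck)

Stub `stub_huygensNeck` (statement `KirchhoffFormula → HuygensNeckLemma`, both unfolded): for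
`φ` smooth on `E4` with `□_η φ = 0` on `{y⁰ ≥ T, |ȳ| ≥ R₀}` and a monotone sublinear wall profile
`ρ ≥ R₀ + 2`, the `C³` shell certificate (cyl), the `C²` flat certificate (flat) and the starved
cone ledger (cone) force the `C²` sup of `φ` on the necks `{y⁰ = s, R₀ + 1 ≤ |ȳ| ≤ ρ(s)}` to tend
to `0`.  PROOF: Kirchhoff's formula (the hypothesis) applied to `g = (y ↦ Dᵐψ(y)·v)`, `m ≤ 2`,
`ψ = χ(|ȳ|)φ` the cutoff field of `…StubHuygensNeckCutoff`, at a late apex with a radius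
`σ ∈ [4ρ(t), 5ρ(t)]` chosen by the pigeonhole of `…StubHuygensNeckSphere`: the far-sphere term is
bounded by (flat) at time `t − σ`, the focusing term by the cone ledger (pointwise AM–GM on the
sphere), the Duhamel term by (cyl) through the source bound and the geometry
`∫_{B(0,R₀+1)} dz/|z − x| ≤ C(R₀)`; all bounds are uniform in the apex (`apex_estimate`).
-/

noncomputable section

namespace Summit.FinalStateConjecture.FinalStateConjecture.Theorems.NecksCertifyTwoCap.Huygens

open scoped Manifold ContDiff Topology ENNReal
open Filter Set MeasureTheory Metric Topology Literature.Geometry.Lorentzian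

set_option linter.dupNamespace false

/-! ### Small tools -/

/-- **An average is bounded by a pointwise bound.** -/
theorem abs_average_le {h : sphere (0 : E3) 1 → ℝ} {B : ℝ} (hB : ∀ w, |h w| ≤ B) :
    |((((volume : Measure E3).toSphere) univ).toReal)⁻¹ *
        ∫ w, h w ∂((volume : Measure E3).toSphere)| ≤ B := by
  have hc := toSphere_univ_toReal_pos
  have h1 : ‖∫ w, h w ∂((volume : Measure E3).toSphere)‖ ≤
      B * ((volume : Measure E3).toSphere).real univ :=
    norm_integral_le_of_norm_le_const (Eventually.of_forall fun w ↦ by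
      rw [Real.norm_eq_abs]; exact hB w)
  rw [abs_mul, abs_inv, abs_of_pos hc]
  rw [Real.norm_eq_abs, measureReal_def] at h1
  calc _ ≤ ((((volume : Measure E3).toSphere) univ).toReal)⁻¹ *
        (B * (((volume : Measure E3).toSphere) univ).toReal) := by gcongr
    _ = B := by field_simp

/-- `‖(t, y)‖² = t² + ‖y‖²` in `E4`. -/
theorem norm_ofTimeSpace_sq (t : ℝ) (y : E3) : ‖E4.ofTimeSpace t y‖ ^ 2 = t ^ 2 + ‖y‖ ^ 2 := by
  rw [EuclideanSpace.norm_sq_eq, EuclideanSpace.norm_sq_eq, Fin.sum_univ_succ]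
  simp [sq_abs]

/-- `‖(1, w)‖ ≤ 2` for a unit vector `w`. -/
theorem norm_ofTimeSpace_one_le (w : sphere (0 : E3) 1) : ‖E4.ofTimeSpace 1 (w : E3)‖ ≤ 2 := by
  have h := norm_ofTimeSpace_sq 1 (w : E3)
  rw [norm_eq_of_mem_sphere w] at h
  nlinarith [norm_nonneg (E4.ofTimeSpace 1 (w : E3))]

/-- A `supCkENorm` is bounded by a uniform pointwise bound. -/
theorem supCkENorm_le_of_forall {S : Set E4} {k : ℕ} {f : E4 → ℝ} {ε : ℝ≥0∞}
    (h : ∀ m ≤ k, ∀ y ∈ S, ‖iteratedFDeriv ℝ m f y‖ₑ ≤ ε) : supCkENorm S k f ≤ ε :=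
  iSup₂_le fun m hm ↦ iSup₂_le fun y hy ↦ h m hm y hy

/-- Pointwise real bound from a `supCkENorm` bound. -/
theorem norm_le_of_supCkENorm_le {S : Set E4} {k : ℕ} {f : E4 → ℝ} {ε : ℝ} (hε : 0 ≤ ε)
    (h : supCkENorm S k f ≤ ENNReal.ofReal ε) {m : ℕ} (hm : m ≤ k) {y : E4} (hy : y ∈ S) :
    ‖iteratedFDeriv ℝ m f y‖ ≤ ε := by
  have := (enorm_iteratedFDeriv_le_supCkENorm hm hy f).trans h
  rwa [← ofReal_norm, ENNReal.ofReal_le_ofReal_iff hε] at this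

/-- Extracting a threshold from an `ℝ≥0∞`-valued `Tendsto … (𝓝 0)`. -/
theorem exists_forall_le_of_tendsto {u : ℝ → ℝ≥0∞} (h : Tendsto u atTop (𝓝 0)) {ε : ℝ}
    (hε : 0 < ε) : ∃ S : ℝ, ∀ s, S ≤ s → u s ≤ ENNReal.ofReal ε :=
  eventually_atTop.1 (ENNReal.tendsto_nhds_zero.1 h (ENNReal.ofReal ε) (ENNReal.ofReal_pos.2 hε))

/-! ### The estimate at one late apex -/

/-- **The apex estimate.**  Kirchhoff's formula for `g = (y ↦ Dᵐψ(y)·v)` at a late neck apex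
`(t, x)` with a pigeonholed radius `σ ∈ [4ρ(t), 5ρ(t)]`: the three terms are bounded by the flat
bound `ε₁`, the cone ledger `e` (with a free AM–GM parameter `λ`), and the shell bound `ε₂`. -/
theorem apex_estimate
    (hK : ∀ (ψ : E4 → ℝ), ContDiff ℝ ∞ ψ → ∀ (t : ℝ) (x : E3) (σ : ℝ), 0 < σ →
      ψ (E4.ofTimeSpace t x) =
        (((volume : Measure E3).toSphere univ).toReal)⁻¹ *
            ∫ (w : Metric.sphere (0 : E3) 1), ψ (E4.ofTimeSpace (t - σ) (x + σ • (w : E3)))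
              ∂((volume : Measure E3).toSphere)
        + σ * ((((volume : Measure E3).toSphere univ).toReal)⁻¹ *
            ∫ (w : Metric.sphere (0 : E3) 1),
              fderiv ℝ ψ (E4.ofTimeSpace (t - σ) (x + σ • (w : E3))) (E4.ofTimeSpace 1 (w : E3))
              ∂((volume : Measure E3).toSphere))
        - ∫ s in (0 : ℝ)..σ, s * ((((volume : Measure E3).toSphere univ).toReal)⁻¹ *
            ∫ (w : Metric.sphere (0 : E3) 1),
              KerrSchild.waveOperator (fun _ ↦ Kerr.etaComp) ψ
                (E4.ofTimeSpace (t - s) (x + s • (w : E3)))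
              ∂((volume : Measure E3).toSphere)))
    {φ ψ : E4 → ℝ} {T R₀ K : ℝ} {ρ : ℝ → ℝ} (hφ : ContDiff ℝ ∞ φ)
    (hψ : ContDiff ℝ ∞ ψ) (hψφ : ∀ y, R₀ + 2 / 3 < E4.spatialNorm y → ψ =ᶠ[𝓝 y] φ) (hK0 : 0 ≤ K)
    (hsrc : ∀ (m : ℕ), m ≤ 2 → ∀ (v : Fin m → E4) (y : E4),
        (T < y 0 →
          |KerrSchild.waveOperator (fun _ ↦ Kerr.etaComp)
              (fun z ↦ iteratedFDeriv ℝ m ψ z v) y| ≤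
            K * (∑ j ∈ Finset.range 4, ‖iteratedFDeriv ℝ j φ y‖) * ∏ i, ‖v i‖) ∧
        (E4.spatialNorm y < R₀ + 1 / 3 →
          KerrSchild.waveOperator (fun _ ↦ Kerr.etaComp)
            (fun z ↦ iteratedFDeriv ℝ m ψ z v) y = 0) ∧
        (T < y 0 → R₀ + 2 / 3 < E4.spatialNorm y →
          KerrSchild.waveOperator (fun _ ↦ Kerr.etaComp)
            (fun z ↦ iteratedFDeriv ℝ m ψ z v) y = 0))
    (hmono : Monotone ρ) (hρ : ∀ s, R₀ + 2 ≤ ρ s) {ε₁ ε₂ e M t : ℝ} (hε₁ : 0 ≤ ε₁)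
    (hε₂ : 0 ≤ ε₂) (he : 0 < e)
    (hflat : ∀ y : E4, M ≤ y 0 → ρ (y 0) ≤ E4.spatialNorm y →
      ∀ j ≤ 2, ‖iteratedFDeriv ℝ j φ y‖ ≤ ε₁)
    (hcyl : ∀ y : E4, M ≤ y 0 → R₀ ≤ E4.spatialNorm y → E4.spatialNorm y ≤ R₀ + 1 →
      ∀ j ≤ 3, ‖iteratedFDeriv ℝ j φ y‖ ≤ ε₂)
    (hTM : T < M) (ht : M ≤ t - 5 * ρ t) (hR₀ : 0 < R₀) {x : E3} (hx1 : R₀ + 1 ≤ ‖x‖)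
    (hx2 : ‖x‖ ≤ ρ t)
    (hcone : ∫ z in {z : E3 | 4 * ρ t ≤ ‖z - x‖ ∧ ‖z - x‖ ≤ 5 * ρ t},
        (∑ m ∈ Finset.Icc 1 3, ‖iteratedFDeriv ℝ m φ (E4.ofTimeSpace (t - ‖z - x‖) z)‖ ^ 2)
      ≤ e * ρ t)
    {m : ℕ} (hm : m ≤ 2) {lam : ℝ} (hlam : 0 < lam) :
    ‖iteratedFDeriv ℝ m φ (E4.ofTimeSpace t x)‖ ≤
      ε₁ + (lam / 2 + 2 * e / (lam * ((volume : Measure E3).toSphere univ).toReal)) +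
        (((volume : Measure E3).toSphere univ).toReal)⁻¹ * (K * (4 * ε₂)) *
        ((volume : Measure E3).toSphere univ + volume (closedBall (0 : E3) (R₀ + 1))).toReal := by
  have hc : 0 < ((volume : Measure E3).toSphere univ).toReal := toSphere_univ_toReal_pos
  have hCg : 0 ≤ ((volume : Measure E3).toSphere univ +
      volume (closedBall (0 : E3) (R₀ + 1))).toReal := ENNReal.toReal_nonneg
  have hρ2 : R₀ + 2 ≤ ρ t := hρ t
  have hρt : 0 < ρ t := by linarith
  -- the cone radius
  have hGc : Continuous fun z : E3 ↦ ∑ j ∈ Finset.Icc 1 3,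
      ‖iteratedFDeriv ℝ j φ (E4.ofTimeSpace (t - ‖z - x‖) z)‖ ^ 2 := by
    refine continuous_finsetSum _ fun j _ ↦ ?_
    refine ((hφ.continuous_iteratedFDeriv (by exact_mod_cast le_top)).comp ?_).norm.pow 2
    exact continuous_uncurry_ofTimeSpace.comp
      ((continuous_const.sub ((continuous_id.sub continuous_const).norm)).prodMk continuous_id)
  have hG0 : ∀ z : E3, 0 ≤ ∑ j ∈ Finset.Icc 1 3,
      ‖iteratedFDeriv ℝ j φ (E4.ofTimeSpace (t - ‖z - x‖) z)‖ ^ 2 :=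
    fun z ↦ Finset.sum_nonneg fun j _ ↦ sq_nonneg _
  obtain ⟨σ, hσI, hσL2⟩ := exists_radius_sphere_lintegral_le (e := e) (by positivity : 0 < 4 * ρ t)
    (by linarith : 4 * ρ t < 5 * ρ t) hGc hG0
    (by rw [show e * (5 * ρ t - 4 * ρ t) = e * ρ t by ring]; exact hcone)
  have hσpos : 0 < σ := by linarith [hσI.1]
  -- geometry of the spheres about `x`
  have hsph : ∀ (s : ℝ) (w : sphere (0 : E3) 1), 0 < s → s - ‖x‖ ≤ ‖x + s • (w : E3)‖ := by
    intro s w hs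
    have h1 : ‖s • (w : E3)‖ = s := norm_smul_sphere hs w
    have h2 : ‖x + s • (w : E3) - x‖ ≤ ‖x + s • (w : E3)‖ + ‖x‖ := norm_sub_le _ _
    rw [add_sub_cancel_left, h1] at h2
    linarith
  have hfar : ∀ w : sphere (0 : E3) 1, 3 * ρ t ≤ ‖x + σ • (w : E3)‖ := fun w ↦ by
    have := hsph σ w hσpos; linarith [hσI.1]
  have htime : M ≤ t - σ := by linarith [hσI.2]
  -- `ψ`-derivatives are `φ`-derivatives far out
  have hψφ' : ∀ (k : ℕ) (z : E4), R₀ + 2 / 3 < E4.spatialNorm z →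
      iteratedFDeriv ℝ k ψ z = iteratedFDeriv ℝ k φ z :=
    fun k z hz ↦ ((hψφ z hz).iteratedFDeriv ℝ k).eq_of_nhds
  -- reduce to a bound on `Dᵐψ(t,x)·v`
  have hyfar : R₀ + 2 / 3 < E4.spatialNorm (E4.ofTimeSpace t x) := by
    rw [E4.spatialNorm_ofTimeSpace]; linarith
  rw [← hψφ' m _ hyfar]
  refine ContinuousMultilinearMap.opNorm_le_bound (by positivity) fun v ↦ ?_
  have hP : 0 ≤ ∏ i, ‖v i‖ := Finset.prod_nonneg fun i _ ↦ norm_nonneg _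
  -- Kirchhoff for `g = (z ↦ Dᵐψ(z)·v)`
  have hKg := hK (fun z ↦ iteratedFDeriv ℝ m ψ z v) (contDiff_iteratedFDeriv_apply hψ v) t x σ
    hσpos
  rw [Real.norm_eq_abs, hKg]
  -- (i) the far-sphere term
  have hT1 : |(((volume : Measure E3).toSphere univ).toReal)⁻¹ *
      ∫ w, iteratedFDeriv ℝ m ψ (E4.ofTimeSpace (t - σ) (x + σ • (w : E3))) v
        ∂(volume : Measure E3).toSphere|
      ≤ ε₁ * ∏ i, ‖v i‖ := by
    refine abs_average_le fun w ↦ ?_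
    have hzn : E4.spatialNorm (E4.ofTimeSpace (t - σ) (x + σ • (w : E3))) = ‖x + σ • (w : E3)‖ :=
      E4.spatialNorm_ofTimeSpace _ _
    have hzfar : R₀ + 2 / 3 < E4.spatialNorm (E4.ofTimeSpace (t - σ) (x + σ • (w : E3))) := by
      rw [hzn]; linarith [hfar w]
    have h1 : ‖iteratedFDeriv ℝ m φ (E4.ofTimeSpace (t - σ) (x + σ • (w : E3)))‖ ≤ ε₁ := by
      refine hflat _ (by rw [E4.ofTimeSpace_apply_zero]; exact htime) ?_ m hm
      rw [hzn, E4.ofTimeSpace_apply_zero]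
      calc ρ (t - σ) ≤ ρ t := hmono (by linarith)
        _ ≤ 3 * ρ t := by linarith
        _ ≤ _ := hfar w
    calc _ ≤ ‖iteratedFDeriv ℝ m ψ (E4.ofTimeSpace (t - σ) (x + σ • (w : E3)))‖ * ∏ i, ‖v i‖ :=
          abs_iteratedFDeriv_apply_le ψ v _
      _ ≤ ε₁ * ∏ i, ‖v i‖ := by
          rw [hψφ' m _ hzfar]; exact mul_le_mul_of_nonneg_right h1 hP
  -- (ii) the focusing term
  have hT2 : |σ * ((((volume : Measure E3).toSphere univ).toReal)⁻¹ *
      ∫ w, fderiv ℝ (fun z ↦ iteratedFDeriv ℝ m ψ z v)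
        (E4.ofTimeSpace (t - σ) (x + σ • (w : E3))) (E4.ofTimeSpace 1 (w : E3))
          ∂(volume : Measure E3).toSphere)| ≤
      (∏ i, ‖v i‖) * (lam / 2 + 2 * e / (lam * ((volume : Measure E3).toSphere univ).toReal)) := by
    refine abs_focusing_le (F := fun w ↦ ‖iteratedFDeriv ℝ (m + 1) φ
      (E4.ofTimeSpace (t - σ) (x + σ • (w : E3)))‖) hσpos.le hP he.le hlam ?_ ?_
    · intro w
      have hzfar : R₀ + 2 / 3 < E4.spatialNorm (E4.ofTimeSpace (t - σ) (x + σ • (w : E3))) := by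
        rw [E4.spatialNorm_ofTimeSpace]; linarith [hfar w]
      calc |fderiv ℝ (fun z ↦ iteratedFDeriv ℝ m ψ z v) (E4.ofTimeSpace (t - σ) (x + σ • (w : E3)))
            (E4.ofTimeSpace 1 (w : E3))|
          ≤ ‖iteratedFDeriv ℝ (m + 1) ψ (E4.ofTimeSpace (t - σ) (x + σ • (w : E3)))‖ *
              ‖E4.ofTimeSpace 1 (w : E3)‖ * ∏ i, ‖v i‖ := by
            rw [← Real.norm_eq_abs]; exact norm_fderiv_iteratedFDeriv_apply_le hψ v _ _
        _ ≤ ‖iteratedFDeriv ℝ (m + 1) ψ (E4.ofTimeSpace (t - σ) (x + σ • (w : E3)))‖ * 2 *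
              ∏ i, ‖v i‖ :=
            mul_le_mul_of_nonneg_right (mul_le_mul_of_nonneg_left (norm_ofTimeSpace_one_le w)
              (norm_nonneg _)) hP
        _ = 2 * ‖iteratedFDeriv ℝ (m + 1) φ (E4.ofTimeSpace (t - σ) (x + σ • (w : E3)))‖ *
              ∏ i, ‖v i‖ := by rw [hψφ' (m + 1) _ hzfar]; ring
    · refine le_trans (lintegral_mono fun w ↦ ENNReal.ofReal_le_ofReal ?_) hσL2
      have hnorm : ‖x + σ • (w : E3) - x‖ = σ := by
        rw [add_sub_cancel_left, norm_smul_sphere hσpos w]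
      simp only [hnorm]
      refine mul_le_mul_of_nonneg_left ?_ (sq_nonneg σ)
      exact Finset.single_le_sum (f := fun j ↦ ‖iteratedFDeriv ℝ j φ
        (E4.ofTimeSpace (t - σ) (x + σ • (w : E3)))‖ ^ 2) (fun j _ ↦ sq_nonneg _)
        (Finset.mem_Icc.2 ⟨by omega, by omega⟩)
  -- (iii) the Duhamel term
  have hQ : ∀ s, 0 < s → s ≤ σ → ∀ w : sphere (0 : E3) 1,
      |KerrSchild.waveOperator (fun _ ↦ Kerr.etaComp) (fun z ↦ iteratedFDeriv ℝ m ψ z v)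
        (E4.ofTimeSpace (t - s) (x + s • (w : E3)))| ≤ K * (4 * ε₂) * (∏ i, ‖v i‖) *
        (closedBall (0 : E3) (R₀ + 1)).indicator (fun _ ↦ (1 : ℝ)) (x + s • (w : E3)) := by
    intro s hs0 hsσ w
    have hzn : E4.spatialNorm (E4.ofTimeSpace (t - s) (x + s • (w : E3))) = ‖x + s • (w : E3)‖ :=
      E4.spatialNorm_ofTimeSpace _ _
    have hz0 : E4.ofTimeSpace (t - s) (x + s • (w : E3)) 0 = t - s := E4.ofTimeSpace_apply_zero _ _
    have hzM : M ≤ E4.ofTimeSpace (t - s) (x + s • (w : E3)) 0 := by rw [hz0]; linarith [hσI.2]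
    have hzT : T < E4.ofTimeSpace (t - s) (x + s • (w : E3)) 0 := hTM.trans_le hzM
    obtain ⟨hb, hin, hout⟩ := hsrc m hm v (E4.ofTimeSpace (t - s) (x + s • (w : E3)))
    have hind0 : 0 ≤ K * (4 * ε₂) * (∏ i, ‖v i‖) *
        (closedBall (0 : E3) (R₀ + 1)).indicator (fun _ ↦ (1 : ℝ)) (x + s • (w : E3)) :=
      mul_nonneg (mul_nonneg (mul_nonneg hK0 (by positivity)) hP)
        (indicator_nonneg (fun _ _ ↦ zero_le_one) _)
    by_cases h1 : ‖x + s • (w : E3)‖ < R₀ + 1 / 3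
    · rw [hin (by rwa [hzn]), abs_zero]
      exact hind0
    by_cases h2 : R₀ + 1 < ‖x + s • (w : E3)‖
    · rw [hout hzT (by rw [hzn]; linarith), abs_zero]
      exact hind0
    push Not at h1 h2
    have hmem : x + s • (w : E3) ∈ closedBall (0 : E3) (R₀ + 1) := by
      simpa [mem_closedBall, dist_zero_right] using h2
    rw [indicator_of_mem hmem, mul_one]
    refine (hb hzT).trans ?_
    have hS : ∑ j ∈ Finset.range 4,
        ‖iteratedFDeriv ℝ j φ (E4.ofTimeSpace (t - s) (x + s • (w : E3)))‖ ≤ 4 * ε₂ := by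
      calc ∑ j ∈ Finset.range 4, ‖iteratedFDeriv ℝ j φ (E4.ofTimeSpace (t - s) (x + s • (w : E3)))‖
          ≤ ∑ _j ∈ Finset.range 4, ε₂ :=
            Finset.sum_le_sum fun j hj ↦ hcyl _ hzM (by rw [hzn]; linarith) (by rwa [hzn]) j
              (by have := Finset.mem_range.1 hj; omega)
        _ = 4 * ε₂ := by simp
    exact mul_le_mul_of_nonneg_right (mul_le_mul_of_nonneg_left hS hK0) hP
  have hT3 := abs_duhamel_le (x := x) (R := R₀ + 1) (σ := σ)
    (mul_nonneg (mul_nonneg hK0 (by positivity)) hP) hσpos.le hQ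
  -- combine
  have key : ∀ (a b d A B D : ℝ), |a| ≤ A → |b| ≤ B → |d| ≤ D → |a + b - d| ≤ A + B + D := by
    intro a b d A B D ha hb hd
    calc |a + b - d| ≤ |a + b| + |d| := abs_sub _ _
      _ ≤ |a| + |b| + |d| := by linarith [abs_add_le a b]
      _ ≤ A + B + D := by linarith
  refine (key _ _ _ _ _ _ hT1 hT2 hT3).trans (le_of_eq ?_)
  ring

/-! ### The registered stub -/

/-- Registered stub M2 (statement = `KirchhoffFormula → HuygensNeckLemma`, both unfolded): the
**Huygens neck lemma** — Kirchhoff's formula for `□_η`, applied to the derivatives of the cut-off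
field at late neck apexes with a pigeonholed cone radius, turns the shell certificate (cyl), the
flat certificate (flat) and the starved cone ledger (cone) into `C²`-smallness on the necks. -/
theorem stub_huygensNeck :
  (∀ (ψ : E4 → ℝ), ContDiff ℝ ∞ ψ → ∀ (t : ℝ) (x : E3) (σ : ℝ), 0 < σ →
    ψ (E4.ofTimeSpace t x) =
      (((volume : Measure E3).toSphere univ).toReal)⁻¹ *
          ∫ (w : Metric.sphere (0 : E3) 1), ψ (E4.ofTimeSpace (t - σ) (x + σ • (w : E3)))
            ∂((volume : Measure E3).toSphere)
      + σ * ((((volume : Measure E3).toSphere univ).toReal)⁻¹ *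
          ∫ (w : Metric.sphere (0 : E3) 1),
            fderiv ℝ ψ (E4.ofTimeSpace (t - σ) (x + σ • (w : E3))) (E4.ofTimeSpace 1 (w : E3))
            ∂((volume : Measure E3).toSphere))
      - ∫ s in (0 : ℝ)..σ, s * ((((volume : Measure E3).toSphere univ).toReal)⁻¹ *
          ∫ (w : Metric.sphere (0 : E3) 1),
            KerrSchild.waveOperator (fun _ ↦ Kerr.etaComp) ψ (E4.ofTimeSpace (t - s) (x + s • (w : E3)))
            ∂((volume : Measure E3).toSphere))) →
  ∀ (φ : E4 → ℝ) (T R₀ : ℝ) (ρ : ℝ → ℝ), 0 < R₀ → ContDiff ℝ ∞ φ →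
    (∀ y : E4, T ≤ y 0 → R₀ ≤ E4.spatialNorm y →
      KerrSchild.waveOperator (fun _ ↦ Kerr.etaComp) φ y = 0) →
    Monotone ρ → (∀ s, R₀ + 2 ≤ ρ s) → Tendsto (fun s ↦ ρ s / s) atTop (𝓝 0) →
    Tendsto (fun s ↦ supCkENorm {y : E4 | y 0 = s ∧ R₀ ≤ E4.spatialNorm y ∧ E4.spatialNorm y ≤ R₀ + 1} 3 φ)
      atTop (𝓝 0) →
    Tendsto (fun s ↦ supCkENorm {y : E4 | y 0 = s ∧ ρ s ≤ E4.spatialNorm y} 2 φ) atTop (𝓝 0) →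
    (∀ e : ℝ, 0 < e → ∃ S : ℝ, ∀ (t : ℝ) (x : E3), S ≤ t → R₀ + 1 ≤ ‖x‖ → ‖x‖ ≤ ρ t →
      ∫ z in {z : E3 | 4 * ρ t ≤ ‖z - x‖ ∧ ‖z - x‖ ≤ 5 * ρ t},
          (∑ m ∈ Finset.Icc 1 3, ‖iteratedFDeriv ℝ m φ (E4.ofTimeSpace (t - ‖z - x‖) z)‖ ^ 2)
        ≤ e * ρ t) →
    Tendsto (fun s ↦ supCkENorm
      {y : E4 | y 0 = s ∧ R₀ + 1 ≤ E4.spatialNorm y ∧ E4.spatialNorm y ≤ ρ s} 2 φ) atTop (𝓝 0) := by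
  intro hK φ T R₀ ρ hR₀ hφ hwave hmono hρ hsub hcyl hflat hcone
  obtain ⟨ψ, hψ, hψφ, K, hK0, hsrc⟩ := exists_cutoff_source hR₀ hφ hwave
  have hc : 0 < ((volume : Measure E3).toSphere univ).toReal := toSphere_univ_toReal_pos
  have hCg : 0 ≤ ((volume : Measure E3).toSphere univ +
      volume (closedBall (0 : E3) (R₀ + 1))).toReal := ENNReal.toReal_nonneg
  rw [ENNReal.tendsto_nhds_zero]
  intro ε hε
  rcases eq_or_ne ε ∞ with hεtop | hεtop
  · exact Eventually.of_forall fun s ↦ hεtop ▸ le_top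
  have hε' : 0 < ε.toReal := ENNReal.toReal_pos hε.ne' hεtop
  -- the three budgets
  obtain ⟨D, hD⟩ : ∃ D : ℝ, D = 4 * ((volume : Measure E3).toSphere univ).toReal⁻¹ * K *
      ((volume : Measure E3).toSphere univ + volume (closedBall (0 : E3) (R₀ + 1))).toReal := ⟨_, rfl⟩
  have hD0 : 0 ≤ D := by rw [hD]; positivity
  have he : 0 < ε.toReal ^ 2 * ((volume : Measure E3).toSphere univ).toReal / 64 := by positivity
  have hε₂ : 0 < ε.toReal / (4 * (D + 1)) := by positivity
  -- thresholds
  obtain ⟨S₁, hS₁⟩ := exists_forall_le_of_tendsto hflat (ε := ε.toReal / 4) (by positivity)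
  obtain ⟨S₂, hS₂⟩ := exists_forall_le_of_tendsto hcyl hε₂
  obtain ⟨S₃, hS₃⟩ := hcone _ he
  obtain ⟨S₄, hS₄⟩ : ∃ S₄ : ℝ, ∀ s, S₄ ≤ s → ρ s / s ≤ 1 / 10 :=
    eventually_atTop.1 (hsub.eventually (Iic_mem_nhds (by norm_num)))
  refine eventually_atTop.2 ⟨max (max S₃ S₄) (max (2 * max (T + 1) (max S₁ S₂)) 1), fun s hs ↦ ?_⟩
  have hs3 : S₃ ≤ s := le_trans (by simp) hs
  have hs4 : S₄ ≤ s := le_trans (by simp) hs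
  have hs1 : 1 ≤ s := le_trans (by simp) hs
  have hsM : 2 * max (T + 1) (max S₁ S₂) ≤ s := le_trans (by simp) hs
  have hρs : ρ s ≤ s / 10 := by
    have h := hS₄ s hs4
    rwa [div_le_iff₀ (by linarith), one_div_mul_eq_div] at h
  have hM : max (T + 1) (max S₁ S₂) ≤ s - 5 * ρ s := by linarith
  have hTM : T < max (T + 1) (max S₁ S₂) := lt_of_lt_of_le (by linarith) (le_max_left _ _)
  have hS₁M : S₁ ≤ max (T + 1) (max S₁ S₂) := le_trans (le_max_left _ _) (le_max_right _ _)
  have hS₂M : S₂ ≤ max (T + 1) (max S₁ S₂) := le_trans (le_max_right _ _) (le_max_right _ _)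
  -- the real bounds behind (flat) and (cyl)
  have hflat' : ∀ y : E4, max (T + 1) (max S₁ S₂) ≤ y 0 → ρ (y 0) ≤ E4.spatialNorm y →
      ∀ j ≤ 2, ‖iteratedFDeriv ℝ j φ y‖ ≤ ε.toReal / 4 := fun y hy hρy j hj ↦
    norm_le_of_supCkENorm_le (by positivity) (hS₁ (y 0) (hS₁M.trans hy)) hj ⟨rfl, hρy⟩
  have hcyl' : ∀ y : E4, max (T + 1) (max S₁ S₂) ≤ y 0 → R₀ ≤ E4.spatialNorm y →
      E4.spatialNorm y ≤ R₀ + 1 → ∀ j ≤ 3, ‖iteratedFDeriv ℝ j φ y‖ ≤ ε.toReal / (4 * (D + 1)) :=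
    fun y hy h1 h2 j hj ↦
      norm_le_of_supCkENorm_le hε₂.le (hS₂ (y 0) (hS₂M.trans hy)) hj ⟨rfl, h1, h2⟩
  -- pointwise on the neck
  refine supCkENorm_le_of_forall fun m hm y hy ↦ ?_
  obtain ⟨hy0, hy1, hy2⟩ := hy
  have hyx : y = E4.ofTimeSpace s (E4.spatial y) := by
    rw [← hy0]; exact (E4.ofTimeSpace_time_spatial y).symm
  rw [← ofReal_norm, ← ENNReal.ofReal_toReal hεtop]
  refine ENNReal.ofReal_le_ofReal ?_
  rw [hyx]
  have hxs : ‖E4.spatial y‖ ≤ ρ s := hy2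
  refine (apex_estimate hK hφ hψ hψφ hK0 hsrc hmono hρ (by positivity) hε₂.le he hflat' hcyl'
    hTM hM hR₀ hy1 hxs (hS₃ s (E4.spatial y) hs3 hy1 hxs) hm
    (by positivity : 0 < ε.toReal / 4)).trans ?_
  -- the budget arithmetic
  have h2 : ε.toReal / 4 / 2 + 2 * (ε.toReal ^ 2 * ((volume : Measure E3).toSphere univ).toReal / 64) /
      (ε.toReal / 4 * ((volume : Measure E3).toSphere univ).toReal) =
      ε.toReal / 4 := by
    field_simp
    ring
  have h3 : ((volume : Measure E3).toSphere univ).toReal⁻¹ * (K * (4 * (ε.toReal / (4 * (D + 1))))) *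
      ((volume : Measure E3).toSphere univ + volume (closedBall (0 : E3) (R₀ + 1))).toReal =
        ε.toReal / 4 * (D / (D + 1)) := by
    rw [hD]
    field_simp
  have h4 : D / (D + 1) ≤ 1 := (div_le_one (by positivity)).2 (by linarith)
  rw [h2, h3]
  nlinarith [mul_le_mul_of_nonneg_left h4 (by positivity : 0 ≤ ε.toReal / 4)]

end Summit.FinalStateConjecture.FinalStateConjecture.Theorems.NecksCertifyTwoCap.Huygens
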